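import Summits.NavierStokesRegularity.NavierStokesRegularity.Theorems.HubbleDynamoNoSelfExcitedDynamoStubOseenRepresentative
import Summits.NavierStokesRegularity.NavierStokesRegularity.Theorems.HubbleDynamoNoSelfExcitedDynamoStubClassicalOfOseen
import Summits.NavierStokesRegularity.NavierStokesRegularity.Theorems.HubbleDynamoNoSelfExcitedDynamoStubDerivativeDecay
import Summits.NavierStokesRegularity.NavierStokesRegularity.Theorems.HubbleDynamoNoSelfExcitedDynamoBackusRegime
import Literature.Analysis.FluidPDE.AncientSimilarityVariables
import Literature.Analysis.FluidPDE.KNSSLiouvilleBridge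
import Literature.Analysis.FluidPDE.NSBoundedMildOseen
import HarnessLib

/-!
# Crux `NoSelfExcitedDynamo` (stmt-NavierStokesRegularity-1934), line `registered`: the reduction to an
  eternal Liouville problem in similarity variables, and the small-constant case

Theorems file (lands `--supports stmt-NavierStokesRegularity-1934`; registered sub-goals
`stub_eternalReduction`, `stub_smallConstantLiouville`). It makes durable the closed part of the line's
skeleton (`Cruxes/NoSelfExcitedDynamo/Lines/birth.lean`):

* `reduction_pipeline` — from the crux's hypotheses (bounded ancient mild solution `u` in the duality
  form, `ν = 1`, measurable slices, pointwise Type-I bound `‖u(t,x)‖ ≤ C/(‖x‖ + √(−t))`) to an ETERNAL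
  classical solution `(U, P) = (lerayOrbit v, lerayOrbitPressure p)` of Leray's backward system on
  `ℝ × ℝ³` in the uniform profile class `(1+‖y‖)^{k+1}‖DᵏU‖ ≤ K_k`, with `‖U(s,y)‖ ≤ C`, the forward
  switch-off `‖U(s,y)‖ ≤ M e^{−s/2}` (from the boundedness of `u` near `t = 0`), and the return ticket
  `U ≡ 0 ⇒ u(t) = 0 a.e. for every t < 0` (landed stubs `stub_oseenRepresentative`,
  `stub_classicalOfOseen`, `stub_derivativeDecay`; the tree's dictionary
  `isClassicalNSSolutionOn_Iio_iff_isBackwardLeraySolutionOn`; KNSS's upgrade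
  `IsBoundedAncientMildSolution.ae_eq_zero_of_ae_restrict`).
* `stub_eternalReduction` — the crux FOLLOWS from the eternal Liouville statement "every eternal
  backward-Leray solution in the uniform profile class which switches off like `e^{−s/2}` as `s → +∞`
  is zero" (the honest remaining content of the line; by the same dictionary it is also implied by the
  crux, so the two are equivalent formulations).
* `stub_smallConstantLiouville` — the crux restricted to Type-I constants `C < 1` (Leray's constant,
  `R_m = C²/(aν) < 2`) is an unconditional theorem: the profile then has `sup ‖U‖ ≤ C < 1` and the
  Backus regime (`stub_backusRegime`) applies. This is the small-constant KNSS-class Liouville theorem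
  with an explicit threshold.
-/

noncomputable section

-- the mandated stub namespace repeats `NavierStokesRegularity` (tree precedent for this crux's stubs)
set_option linter.dupNamespace false

namespace Summit.NavierStokesRegularity.NavierStokesRegularity.Theorems.NoSelfExcitedDynamo.Registered

open Set MeasureTheory Filter Topology
open scoped ContDiff
open Literature.Analysis.FluidPDE

/-! ### Glue: a.e. versus everywhere for continuous functions -/

/-- An a.e. inequality between continuous real functions on `ℝ³` holds everywhere (Lebesgue
measure charges open sets: the continuous function `max (f − g) 0` vanishes a.e., hence everywhere). -/
theorem reduction_le_of_ae_le_of_continuous {f g : EuclideanSpace ℝ (Fin 3) → ℝ} (hf : Continuous f)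
    (hg : Continuous g)
    (h : ∀ᵐ x ∂(volume : Measure (EuclideanSpace ℝ (Fin 3))), f x ≤ g x) : ∀ x, f x ≤ g x := by
  have hc : Continuous fun x => max (f x - g x) 0 := (hf.sub hg).max continuous_const
  have hae : (fun x => max (f x - g x) 0)
      =ᵐ[(volume : Measure (EuclideanSpace ℝ (Fin 3))).restrict univ] fun _ => (0 : ℝ) := by
    rw [Measure.restrict_univ]
    filter_upwards [h] with x hx
    exact max_eq_right (by linarith)
  have key := Measure.eqOn_open_of_ae_eq hae isOpen_univ hc.continuousOn continuousOn_const
  intro x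
  have hx : max (f x - g x) 0 = 0 := key (mem_univ x)
  have hle : f x - g x ≤ max (f x - g x) 0 := le_max_left _ _
  rw [hx] at hle
  linarith

/-- An inequality between two real functions continuous on the open past `(−∞, 0)` which holds at
a.e. negative time holds at every negative time (Lebesgue measure on `ℝ` charges open sets). -/
theorem reduction_le_of_ae_restrict_Iio {f g : ℝ → ℝ} (hf : ContinuousOn f (Iio 0))
    (hg : ContinuousOn g (Iio 0))
    (h : ∀ᵐ t ∂((volume : Measure ℝ).restrict (Iio 0)), f t ≤ g t) : ∀ t < 0, f t ≤ g t := by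
  have hc : ContinuousOn (fun t => max (f t - g t) 0) (Iio 0) :=
    (continuous_id.max continuous_const).comp_continuousOn (hf.sub hg)
  have hae : (fun t => max (f t - g t) 0)
      =ᵐ[(volume : Measure ℝ).restrict (Iio 0)] fun _ => (0 : ℝ) := by
    filter_upwards [h] with t ht
    exact max_eq_right (by linarith)
  have key := Measure.eqOn_open_of_ae_eq hae isOpen_Iio hc continuousOn_const
  intro t ht
  have hx : max (f t - g t) 0 = 0 := key (show t ∈ Iio 0 from ht)
  have hle : f t - g t ≤ max (f t - g t) 0 := le_max_left _ _
  rw [hx] at hle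
  linarith

/-- **The Type-I bound passes to a jointly continuous representative.** If `v` is continuous on
`(−∞, 0) × ℝ³`, `v(t) = u(t)` a.e. in space for a.e. `t < 0`, and `u` has the pointwise Type-I bound
with constant `C`, then so has `v`, at EVERY `t < 0` and every `x`. -/
theorem reduction_hasTypeIDecay_of_ae_restrict
    {u v : ℝ → EuclideanSpace ℝ (Fin 3) → EuclideanSpace ℝ (Fin 3)} {C : ℝ}
    (hv : ContinuousOn (Function.uncurry v) (Iio 0 ×ˢ univ))
    (hvu : ∀ᵐ t ∂((volume : Measure ℝ).restrict (Iio 0)), v t =ᵐ[volume] u t)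
    (hC : HasTypeIDecay C u) : HasTypeIDecay C v := by
  have hslice : ∀ t < 0, Continuous (v t) := by
    intro t ht
    have h1 : ContinuousOn (fun x : EuclideanSpace ℝ (Fin 3) => ((t, x) : ℝ × EuclideanSpace ℝ (Fin 3)))
        univ := (continuous_const.prodMk continuous_id).continuousOn
    have := hv.comp h1 (fun x _ => ⟨ht, mem_univ x⟩)
    simpa [continuousOn_univ, Function.comp_def] using this
  have hline : ∀ x, ContinuousOn (fun t => v t x) (Iio 0) := by
    intro x
    have h1 : ContinuousOn (fun t : ℝ => ((t, x) : ℝ × EuclideanSpace ℝ (Fin 3))) (Iio 0) :=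
      (continuous_id.prodMk continuous_const).continuousOn
    have := hv.comp h1 (fun t ht => ⟨ht, mem_univ x⟩)
    simpa [Function.comp_def] using this
  have hgood : ∀ᵐ t ∂((volume : Measure ℝ).restrict (Iio 0)),
      t < 0 → ∀ x, ‖v t x‖ ≤ C / (‖x‖ + Real.sqrt (-t)) := by
    filter_upwards [hvu] with t ht ht0 x
    have hst : 0 < Real.sqrt (-t) := Real.sqrt_pos.2 (by linarith)
    refine reduction_le_of_ae_le_of_continuous (f := fun x => ‖v t x‖)
      (g := fun x => C / (‖x‖ + Real.sqrt (-t))) (hslice t ht0).norm ?_ ?_ x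
    · exact continuous_const.div (continuous_norm.add continuous_const)
        fun x => (add_pos_of_nonneg_of_pos (norm_nonneg _) hst).ne'
    · filter_upwards [ht] with x hx
      rw [hx]
      exact hC t ht0 x
  intro t ht x
  have hae : ∀ᵐ t ∂((volume : Measure ℝ).restrict (Iio 0)),
      ‖v t x‖ ≤ C / (‖x‖ + Real.sqrt (-t)) := by
    rw [ae_restrict_iff' measurableSet_Iio] at hgood ⊢
    filter_upwards [hgood] with t ht ht0
    exact ht ht0 ht0 x
  refine reduction_le_of_ae_restrict_Iio (f := fun t => ‖v t x‖)
    (g := fun t => C / (‖x‖ + Real.sqrt (-t))) (hline x).norm ?_ hae t ht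
  refine continuousOn_const.div (continuousOn_const.add
    (Real.continuous_sqrt.comp continuous_neg).continuousOn) fun t ht => ?_
  have hst : 0 < Real.sqrt (-t) := Real.sqrt_pos.2 (by simpa using ht)
  exact (add_pos_of_nonneg_of_pos (norm_nonneg _) hst).ne'

/-- The pointwise Type-I bound implies KNSS's decay `r ‖u(t,x)‖ ≤ C` (`r ≤ ‖x‖ ≤ ‖x‖ + √(−t)`). -/
theorem reduction_cylRadius_mul_norm_le {u : ℝ → EuclideanSpace ℝ (Fin 3) → EuclideanSpace ℝ (Fin 3)}
    {C : ℝ} (hC : HasTypeIDecay C u) : ∀ t < 0, ∀ x, cylRadius x * ‖u t x‖ ≤ C := by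
  intro t ht x
  have hst : 0 < Real.sqrt (-t) := Real.sqrt_pos.2 (by linarith)
  have hden : 0 < ‖x‖ + Real.sqrt (-t) := add_pos_of_nonneg_of_pos (norm_nonneg _) hst
  have hC0 : 0 ≤ C := by
    have h := (norm_nonneg _).trans (hC t ht x)
    exact (div_nonneg_iff.1 h).elim (fun h => h.1) fun h => absurd h.2 (not_le.2 hden)
  calc cylRadius x * ‖u t x‖ ≤ ‖x‖ * (C / (‖x‖ + Real.sqrt (-t))) :=
        mul_le_mul (SereginSverak2009.cylRadius_le_norm' x) (hC t ht x) (norm_nonneg _) (norm_nonneg _)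
    _ ≤ (‖x‖ + Real.sqrt (-t)) * (C / (‖x‖ + Real.sqrt (-t))) :=
        mul_le_mul_of_nonneg_right (le_add_of_nonneg_right hst.le) (div_nonneg hC0 hden.le)
    _ = C := by field_simp

/-! ### Glue: the dictionary for higher derivatives -/

/-- **The velocity dictionary for higher derivatives**: at fixed `s` the profile
`U(s, ·) = lerayOrbit v s` is the dilation `y ↦ c • v(t, c • y)`, `c = e^{−s/2}`, `t = −e^{−s}`,
so `D^k_y U(s, y) = c^{k+1} • D^k_x v(t, x)` at `x = c • y`. -/
theorem reduction_iteratedFDeriv_lerayOrbit {F : Type*} [NormedAddCommGroup F] [NormedSpace ℝ F]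
    (v : ℝ → EuclideanSpace ℝ (Fin 3) → F) (s : ℝ) (k : ℕ) (hv : ContDiff ℝ k (v (-Real.exp (-s))))
    (y : EuclideanSpace ℝ (Fin 3)) :
    iteratedFDeriv ℝ k (lerayOrbit v s) y =
      Real.exp (-s / 2) ^ (k + 1) •
        iteratedFDeriv ℝ k (v (-Real.exp (-s))) (Real.exp (-s / 2) • y) := by
  have h1 : lerayOrbit v s =
      fun y => Real.exp (-s / 2) • (fun z => v (-Real.exp (-s)) (Real.exp (-s / 2) • z)) y := rfl
  have hg :
      ContDiff ℝ k (fun z : EuclideanSpace ℝ (Fin 3) => v (-Real.exp (-s)) (Real.exp (-s / 2) • z)) :=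
    hv.comp (contDiff_const_smul _)
  rw [h1, iteratedFDeriv_const_smul_apply' hg.contDiffAt, iteratedFDeriv_comp_const_smul _ hv,
    smul_smul, ← pow_succ']

/-- **Scale-invariant physical bounds are uniform profile bounds**: if the slices `v t`, `t < 0`,
are `C^k` and `‖D^k v(t, x)‖ ≤ C' / (‖x‖ + √(−t))^{k+1}`, then
`(1 + ‖y‖)^{k+1} ‖D^k U(s, y)‖ ≤ C'` for the profile `U = lerayOrbit v`. -/
theorem reduction_profileBound {F : Type*} [NormedAddCommGroup F] [NormedSpace ℝ F]
    (v : ℝ → EuclideanSpace ℝ (Fin 3) → F) (k : ℕ) (hv : ∀ t < 0, ContDiff ℝ k (v t)) {C' : ℝ}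
    (hk : ∀ t < 0, ∀ x, ‖iteratedFDeriv ℝ k (v t) x‖ ≤ C' / (‖x‖ + Real.sqrt (-t)) ^ (k + 1)) :
    ∀ s y, (1 + ‖y‖) ^ (k + 1) * ‖iteratedFDeriv ℝ k (lerayOrbit v s) y‖ ≤ C' := by
  intro s y
  set c : ℝ := Real.exp (-s / 2) with hc
  have hcpos : 0 < c := Real.exp_pos _
  have ht : -Real.exp (-s) < 0 := neg_exp_neg_lt_zero s
  have hsqrt : Real.sqrt (-(-Real.exp (-s))) = c := by rw [neg_neg, sqrt_exp_neg]
  have key := hk (-Real.exp (-s)) ht (c • y)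
  rw [hsqrt, norm_smul, Real.norm_of_nonneg hcpos.le,
    show c * ‖y‖ + c = c * (1 + ‖y‖) by ring, mul_pow] at key
  have hden : 0 < c ^ (k + 1) * (1 + ‖y‖) ^ (k + 1) := by positivity
  rw [le_div_iff₀ hden] at key
  rw [reduction_iteratedFDeriv_lerayOrbit v s k (hv _ ht) y, norm_smul,
    Real.norm_of_nonneg (pow_nonneg hcpos.le _)]
  calc (1 + ‖y‖) ^ (k + 1) *
        (Real.exp (-s / 2) ^ (k + 1) * ‖iteratedFDeriv ℝ k (v (-Real.exp (-s))) (c • y)‖)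
      = ‖iteratedFDeriv ℝ k (v (-Real.exp (-s))) (c • y)‖ * (c ^ (k + 1) * (1 + ‖y‖) ^ (k + 1)) := by
        rw [← hc]; ring
    _ ≤ C' := key

/-! ### The pipeline: from the crux's hypotheses to an eternal profile-class solution -/

/-- **The pipeline.** A bounded ancient mild solution `u` (`ν = 1`, duality form) with measurable
slices and the pointwise Type-I bound with constant `C` yields a classical solution `(v, p)` on the
whole past whose similarity transform `(U, P) = (lerayOrbit v, lerayOrbitPressure p)` is an ETERNAL
solution of the backward Leray system in the uniform profile class, with `‖U(s, y)‖ ≤ C`, the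
forward switch-off `‖U(s, y)‖ ≤ M e^{−s/2}`, and such that `U ≡ 0` forces `u(t) = 0` a.e. for EVERY
`t < 0`. Steps: `stub_oseenRepresentative` (continuous bounded Oseen-mild representative, equal to
`u(t)` a.e. for a.e. `t`), `stub_classicalOfOseen` (one pressure on `Iio 0`), the Type-I bound passes
to the continuous `v`, `stub_derivativeDecay`, the dictionary, and for the return ticket the inversion
`eq_lerayOrbit_of_neg` plus `IsBoundedAncientMildSolution.ae_eq_zero_of_ae_restrict`. -/
theorem reduction_pipeline (u : ℝ → EuclideanSpace ℝ (Fin 3) → EuclideanSpace ℝ (Fin 3))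
    (hu : IsBoundedAncientMildSolution 1 u) (hmeas : ∀ t < 0, AEStronglyMeasurable (u t) volume)
    {C : ℝ} (hC : HasTypeIDecay C u) :
    ∃ (v : ℝ → EuclideanSpace ℝ (Fin 3) → EuclideanSpace ℝ (Fin 3))
      (p : ℝ → EuclideanSpace ℝ (Fin 3) → ℝ),
      IsClassicalNSSolutionOn (Iio 0) 1 0 v p ∧ HasTypeIDecay C v ∧
      IsBackwardLeraySolutionOn univ 1 (lerayOrbit v) (lerayOrbitPressure p) ∧
      (∀ k : ℕ, ∃ K : ℝ, ∀ s y, (1 + ‖y‖) ^ (k + 1) * ‖iteratedFDeriv ℝ k (lerayOrbit v s) y‖ ≤ K) ∧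
      (∀ s y, ‖lerayOrbit v s y‖ ≤ C) ∧
      (∃ M : ℝ, ∀ s y, ‖lerayOrbit v s y‖ ≤ M * Real.exp (-s / 2)) ∧
      ((∀ s y, lerayOrbit v s y = 0) →
        ∀ t < 0, u t =ᵐ[volume] (0 : EuclideanSpace ℝ (Fin 3) → EuclideanSpace ℝ (Fin 3))) := by
  obtain ⟨v, hvc, hvb, hvdiv, hvmild, hvu⟩ := stub_oseenRepresentative u hu hmeas ⟨C, hC⟩
  obtain ⟨p, hcl⟩ := stub_classicalOfOseen v hvc hvb hvdiv hvmild
  have hsmooth : ∀ t < 0, ContDiff ℝ ∞ (v t) := fun t ht => hcl.contDiff_velocity ht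
  have hdecv : HasTypeIDecay C v := reduction_hasTypeIDecay_of_ae_restrict hvc hvu hC
  have hder := stub_derivativeDecay v p C hcl hdecv
  have hL : IsBackwardLeraySolutionOn univ 1 (lerayOrbit v) (lerayOrbitPressure p) :=
    isClassicalNSSolutionOn_Iio_iff_isBackwardLeraySolutionOn.1 hcl
  have hprof : ∀ k : ℕ, ∃ K : ℝ, ∀ s y,
      (1 + ‖y‖) ^ (k + 1) * ‖iteratedFDeriv ℝ k (lerayOrbit v s) y‖ ≤ K := by
    intro k
    obtain ⟨C', hC'⟩ := hder k
    exact ⟨C', reduction_profileBound v k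
      (fun t ht => (hsmooth t ht).of_le (by exact_mod_cast le_top)) hC'⟩
  obtain ⟨M, hM⟩ := hvb
  refine ⟨v, p, hcl, hdecv, hL, hprof, fun s y => hdecv.norm_lerayOrbit_le' s y, ⟨M, fun s y => ?_⟩,
    fun hzero => ?_⟩
  · -- forward switch-off: `‖U(s,y)‖ = e^{-s/2} ‖v(t,x)‖ ≤ M e^{-s/2}`
    have e : lerayOrbit v s y = Real.exp (-s / 2) • v (-Real.exp (-s)) (Real.exp (-s / 2) • y) := rfl
    rw [e, norm_smul, Real.norm_of_nonneg (Real.exp_pos _).le, mul_comm]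
    exact mul_le_mul_of_nonneg_right (hM _ (neg_exp_neg_lt_zero s) _) (Real.exp_pos _).le
  · -- return ticket
    have hvt : ∀ t < 0, v t = 0 := by
      intro t ht
      funext x
      rw [eq_lerayOrbit_of_neg v ht x, hzero, smul_zero]
      rfl
    have hzero_ae : ∀ᵐ t ∂(volume.restrict (Iio (0 : ℝ))), u t =ᵐ[volume] 0 := by
      rw [ae_restrict_iff' measurableSet_Iio] at hvu ⊢
      filter_upwards [hvu] with t ht ht0
      filter_upwards [ht ht0] with x hx
      rw [← hx, hvt t ht0]
    exact hu.ae_eq_zero_of_ae_restrict one_pos hmeas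
      ⟨C, fun t ht => Eventually.of_forall (reduction_cylRadius_mul_norm_le hC t ht)⟩ hzero_ae

/-! ### The two registered sub-goals -/

/-- **Reduction of the crux to an eternal Liouville problem** (registered sub-goal
`stub_eternalReduction`): IF every eternal classical solution of Leray's backward system on `ℝ × ℝ³`
in the uniform profile class which switches off like `‖U(s, y)‖ ≤ M e^{−s/2}` (`s → +∞`) vanishes
identically, THEN `NoSelfExcitedDynamo` holds (conclusion written unfolded). The hypothesis is what
the line's open stub `stub_amplitudeSqueeze` plus the Backus regime would deliver; by the dictionary
it is also a consequence of the crux, i.e. an equivalent formulation ("no eternal self-excited field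
in Hubble flow that is Type-I bounded in the past and switches off in the future"). -/
theorem stub_eternalReduction :
    (∀ (U : ℝ → EuclideanSpace ℝ (Fin 3) → EuclideanSpace ℝ (Fin 3)) (P : ℝ → EuclideanSpace ℝ (Fin 3) → ℝ),
      IsBackwardLeraySolutionOn univ 1 U P →
      (∀ k : ℕ, ∃ K : ℝ, ∀ s y, (1 + ‖y‖) ^ (k + 1) * ‖iteratedFDeriv ℝ k (U s) y‖ ≤ K) →
      (∃ M : ℝ, ∀ s y, ‖U s y‖ ≤ M * Real.exp (-s / 2)) →
      ∀ s y, U s y = 0) →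
    ∀ u : ℝ → EuclideanSpace ℝ (Fin 3) → EuclideanSpace ℝ (Fin 3),
      IsBoundedAncientMildSolution 1 u →
      (∀ t < 0, AEStronglyMeasurable (u t) volume) → (∃ C : ℝ, HasTypeIDecay C u) →
      ∀ t < 0, u t =ᵐ[volume] (0 : EuclideanSpace ℝ (Fin 3) → EuclideanSpace ℝ (Fin 3)) := by
  intro hELL u hu hmeas hdec
  obtain ⟨C, hC⟩ := hdec
  obtain ⟨v, p, -, -, hL, hprof, -, hM, hback⟩ := reduction_pipeline u hu hmeas hC
  exact hback (hELL (lerayOrbit v) (lerayOrbitPressure p) hL hprof hM)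

/-- **The small-constant case of the crux is a theorem** (registered sub-goal
`stub_smallConstantLiouville`; Leray's constant): every bounded ancient mild solution of
Navier–Stokes (`ν = 1`, duality form) on `ℝ³ × (−∞, 0)` with measurable slices and the pointwise
Type-I bound `‖u(t, x)‖ ≤ C / (‖x‖ + √(−t))` with `C < 1` has a.e.-zero slices: its similarity profile
obeys `‖U(s, y)‖ ≤ C < 1` (`HasTypeIDecay.norm_lerayOrbit_le'`), so the Backus regime
(`stub_backusRegime`: enstrophy balance with the exact `−¼` dilution bonus, backward Grönwall,
curl-free Liouville) kills the eternal profile, and the pipeline returns to `u`. -/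
theorem stub_smallConstantLiouville :
    ∀ u : ℝ → EuclideanSpace ℝ (Fin 3) → EuclideanSpace ℝ (Fin 3),
      IsBoundedAncientMildSolution 1 u →
      (∀ t < 0, AEStronglyMeasurable (u t) volume) → (∃ C : ℝ, C < 1 ∧ HasTypeIDecay C u) →
      ∀ t < 0, u t =ᵐ[volume] (0 : EuclideanSpace ℝ (Fin 3) → EuclideanSpace ℝ (Fin 3)) := by
  intro u hu hmeas hdec
  obtain ⟨C, hC1, hC⟩ := hdec
  obtain ⟨v, p, -, -, hL, hprof, hsup, -, hback⟩ := reduction_pipeline u hu hmeas hC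
  exact hback (stub_backusRegime (lerayOrbit v) (lerayOrbitPressure p) hL hprof ⟨C, hC1, hsup⟩)

end Summit.NavierStokesRegularity.NavierStokesRegularity.Theorems.NoSelfExcitedDynamo.Registered

end
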